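import Literature.Analysis.FluidPDE.DuchonRobertLionsEnergyEqualityGeneral
import Literature.Analysis.FunctionSpaces.TorusReflectionCalculus
import Literature.Analysis.FunctionSpaces.TorusFourierModes
import Literature.Analysis.FunctionSpaces.TorusFourierSynthesis
import HarnessLib

/-!
# Fourier truncation of smooth vector fields on `T^d` in the `H¹` seminorm; mean mode, band
# limitation, lattice symmetries

Analysis/FunctionSpaces support file (all results proved; no definitions, no named facts) about
the Fourier truncation `P_N u = Torus.fourierTruncate N u` (`TorusTrigPoly`: the real vector
trigonometric polynomial with the Fourier coefficients of `u` on the ball `|k|² ≤ N²` and none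
outside) — the Galerkin projection of the Fourier–Galerkin method for the space-periodic
Navier–Stokes equations (Robinson–Rodrigo–Sadowski 2016, §4.1; Constantin–Foias 1988, Ch. 8;
Temam 1979, Ch. II §1) — complementing the `L²` facts of `TorusTrigPoly` with what the
approximation of STEADY states by band-limited ones needs:

* `Torus.mFourierCoeff_complexify_eq_zero_of_hasZeroMean`, `Torus.hasZeroMean_fourierTruncate`,
  `Torus.mFourierCoeff_fourierTruncate_eq_zero_of_not_mem_erase` — a mean-zero integrable field has
  vanishing zero mode, its truncations are mean-zero and band-limited to the PUNCTURED ball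
  `0 < |k|² ≤ N²`;
* `Torus.eGradNormSq_eq_add_fourierTruncate` — **spectral Pythagoras in `Ḣ¹`**:
  `‖∇u‖₂² = ‖∇P_N u‖₂² + ‖∇(P_N u - u)‖₂²` (the Fourier supports are disjoint), for the spectral
  squared gradient norm `Torus.eGradNormSq` of any integrable `u`; for smooth `u` the classical
  forms `Torus.gradNormSq_eq_add_fourierTruncate`, `Torus.gradNormSq_fourierTruncate_le`
  (`‖∇P_N u‖₂ ≤ ‖∇u‖₂`), and the convergence `‖∇(P_N u - u)‖₂² → 0`, `‖∇P_N u‖₂² → ‖∇u‖₂²`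
  (`Torus.tendsto_gradNormSq_fourierTruncate_sub`, `Torus.tendsto_gradNormSq_fourierTruncate`; the
  `ℝ≥0∞` form is `FluidPDE.Torus.tendsto_eGradNormSq_fourierTruncate_sub`);
* `Torus.integral_inner_fourierTruncate_laplacian_eq` — `⟪P_N u, Δa⟫ = ⟪u, Δa⟫` for smooth `a`
  band-limited to the ball (`𝓕(Δa) = -4π²|k|² 𝓕a` is band-limited too);
* `Torus.fourierTruncate_conj_mulVecT` — **truncation commutes with lattice symmetries**: for an
  automorphism `M` of `ℤ^d` (`M' M = 1`) whose dual action `k ↦ k M'` preserves the ball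
  `|k|² ≤ N²` and any `A ∈ M_d(ℤ)`, `P_N (A_ℝ ∘ u ∘ M•) = A_ℝ ∘ (P_N u) ∘ M•`
  (`Torus.mFourierCoeff_complexify_conj_mulVecT` and uniqueness of Fourier coefficients); hence
  truncations of fields equivariant under a finite group of such symmetries are equivariant.

## Mathlib / tree search

Tree: `Torus.fourierTruncate*`, `Torus.mFourierCoeff_fourierTruncate(_sub)`,
`Torus.integral_inner_fourierTruncate_eq` (`TorusTrigPoly`); `Torus.eGradNormSq_eq_tsum`
(`TorusSpectralWeakDerivative`), `Torus.eGradNormSq_eq_ofReal_gradNormSq` (`TorusFourierCalculus`),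
`FluidPDE.Torus.tendsto_eGradNormSq_fourierTruncate_sub` (`DuchonRobertLionsEnergyEqualityGeneral`),
`Torus.mFourierCoeff_complexify_laplacian` (`TorusFourierModes`), `Torus.IsSmooth.ext_mFourierCoeff`
(`TorusFourierSynthesis`), `Torus.mFourierCoeff_complexify_conj_mulVecT` (`TorusReflectionCalculus`);
a mean-zero-truncation lemma exists only for `Lp` data in `H` (`FluidPDE.Torus.hasZeroMean_fourierTruncate_of_mem`,
`SteadyNavierStokesEnergy`). Mathlib has no Fourier truncation on `UnitAddTorus`.

## References

* J. C. Robinson, J. L. Rodrigo, W. Sadowski, *The Three-Dimensional Navier–Stokes Equations*,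
  CUP 2016, §4.1 and Lemma 4.1. [`RobinsonRodrigoSadowski2016`]
* R. Temam, *Navier–Stokes Equations*, North-Holland 1979, Ch. II §1. [`Temam1979`]
* L. Grafakos, *Classical Fourier Analysis*, 3rd ed. (2014), Prop. 3.2.4, 3.2.6, 3.2.7. [`Grafakos2014`]
-/

noncomputable section

open _root_.MeasureTheory Filter Function UnitAddTorus
open scoped ENNReal InnerProductSpace _root_.Topology BigOperators

namespace Literature.Analysis.FunctionSpaces

namespace Torus

variable {d : Type*} [Fintype d] [DecidableEq d]

/-! ## Mean mode and band limitation of truncations -/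

omit [DecidableEq d] in
/-- The zero Fourier mode of a mean-zero field vanishes: `𝓕(complexify ∘ u)(0) = complexify (∫ u) = 0`.
[folklore] -/
theorem mFourierCoeff_complexify_eq_zero_of_hasZeroMean {u : UnitAddTorus d → EuclideanSpace ℝ d}
    (h0 : HasZeroMean u) : mFourierCoeff (EuclideanSpace.complexify ∘ u) 0 = 0 := by
  rw [mFourierCoeff_eq_integral_volume]
  simp only [neg_zero, mFourier_zero, ContinuousMap.one_apply, one_smul, Function.comp_apply]
  rw [EuclideanSpace.complexify.integral_comp_comm u, h0, map_zero]

/-- **Truncations of mean-zero fields are mean-zero**: `∫ P_N u = 0` if `∫ u = 0` (`u` integrable;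
`complexify (∫ P_N u) = 𝓕(P_N u)(0) = û(0) = 0`). [folklore] -/
theorem hasZeroMean_fourierTruncate {u : UnitAddTorus d → EuclideanSpace ℝ d} (hu : Integrable u volume)
    (h0 : HasZeroMean u) (N : ℕ) : HasZeroMean (fourierTruncate N u) := by
  unfold HasZeroMean
  have h1 : mFourierCoeff (EuclideanSpace.complexify ∘ fourierTruncate N u) 0 = 0 := by
    rw [mFourierCoeff_fourierTruncate hu, if_pos (zero_mem_freqBall N),
      mFourierCoeff_complexify_eq_zero_of_hasZeroMean h0]
  rw [mFourierCoeff_eq_integral_volume] at h1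
  simp only [neg_zero, mFourier_zero, ContinuousMap.one_apply, one_smul, Function.comp_apply] at h1
  rw [EuclideanSpace.complexify.integral_comp_comm (fourierTruncate N u)] at h1
  exact EuclideanSpace.complexify_injective (h1.trans (map_zero _).symm)

/-- **Truncations of mean-zero fields are band-limited to the punctured ball**: the Fourier
coefficients of `P_N u` vanish off `{k : 0 < |k|² ≤ N²}` (`u` integrable with `∫ u = 0`). [folklore] -/
theorem mFourierCoeff_fourierTruncate_eq_zero_of_not_mem_erase {u : UnitAddTorus d → EuclideanSpace ℝ d}
    (hu : Integrable u volume) (h0 : HasZeroMean u) (N : ℕ) {k : d → ℤ}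
    (hk : k ∉ (freqBall N).erase (0 : d → ℤ)) :
    mFourierCoeff (EuclideanSpace.complexify ∘ fourierTruncate N u) k = 0 := by
  rw [mFourierCoeff_fourierTruncate hu]
  by_cases hk0 : k = 0
  · subst hk0
    rw [if_pos (zero_mem_freqBall N), mFourierCoeff_complexify_eq_zero_of_hasZeroMean h0]
  · rw [if_neg fun hkb => hk (Finset.mem_erase.2 ⟨hk0, hkb⟩)]

/-! ## Spectral Pythagoras in `Ḣ¹` and `H¹` convergence of truncations -/

/-- **Spectral Pythagoras**: `‖∇u‖₂² = ‖∇P_N u‖₂² + ‖∇(P_N u - u)‖₂²` for the spectral squared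
gradient norm of an integrable field — `P_N u` carries the modes `|k| ≤ N` of `u` and `P_N u - u`
the others (Robinson–Rodrigo–Sadowski 2016, Lemma 4.1: `P_n` and `Q_n = I - P_n` are orthogonal in
every `H^s`). [cite: RobinsonRodrigoSadowski2016, Lemma 4.1] -/
theorem eGradNormSq_eq_add_fourierTruncate {u : UnitAddTorus d → EuclideanSpace ℝ d}
    (hu : Integrable u volume) (N : ℕ) :
    eGradNormSq u = eGradNormSq (fourierTruncate N u) + eGradNormSq (fourierTruncate N u - u) := by
  rw [eGradNormSq_eq_tsum u, eGradNormSq_eq_tsum (fourierTruncate N u),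
    eGradNormSq_eq_tsum (fourierTruncate N u - u), ← mul_add, ← ENNReal.tsum_add]
  congr 1
  refine tsum_congr fun k => ?_
  rw [mFourierCoeff_fourierTruncate hu, mFourierCoeff_fourierTruncate_sub hu, ← mul_add]
  congr 1
  split_ifs with hk
  · simp
  · simp

/-- Classical form of the spectral Pythagoras for smooth `u`:
`∫ ∑ᵢ‖∂ᵢu‖² = ∫ ∑ᵢ‖∂ᵢP_N u‖² + ∫ ∑ᵢ‖∂ᵢ(P_N u - u)‖²`. [folklore] -/
theorem gradNormSq_eq_add_fourierTruncate {u : UnitAddTorus d → EuclideanSpace ℝ d} (hu : IsSmooth u)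
    (N : ℕ) : gradNormSq u = gradNormSq (fourierTruncate N u) + gradNormSq (fourierTruncate N u - u) := by
  have h := eGradNormSq_eq_add_fourierTruncate hu.integrable N
  rw [eGradNormSq_eq_ofReal_gradNormSq hu, eGradNormSq_eq_ofReal_gradNormSq (isSmooth_fourierTruncate N u),
    eGradNormSq_eq_ofReal_gradNormSq ((isSmooth_fourierTruncate N u).sub hu),
    ← ENNReal.ofReal_add (gradNormSq_nonneg _) (gradNormSq_nonneg _)] at h
  exact (ENNReal.ofReal_eq_ofReal_iff (gradNormSq_nonneg _)
    (add_nonneg (gradNormSq_nonneg _) (gradNormSq_nonneg _))).1 h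

/-- **Truncation does not increase the gradient norm**: `‖∇P_N u‖₂² ≤ ‖∇u‖₂²` for smooth `u`.
[folklore] -/
theorem gradNormSq_fourierTruncate_le {u : UnitAddTorus d → EuclideanSpace ℝ d} (hu : IsSmooth u)
    (N : ℕ) : gradNormSq (fourierTruncate N u) ≤ gradNormSq u := by
  rw [gradNormSq_eq_add_fourierTruncate hu N]
  exact le_add_of_nonneg_right (gradNormSq_nonneg _)

/-- **`P_N u → u` in `Ḣ¹`** for smooth `u`, classical form: `∫ ∑ᵢ‖∂ᵢ(P_N u - u)‖² → 0`
(the tail of the convergent series `4π² ∑ |k|² ‖û(k)‖²`; Robinson–Rodrigo–Sadowski 2016, Lemma 4.1).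
[cite: RobinsonRodrigoSadowski2016, Lemma 4.1] -/
theorem tendsto_gradNormSq_fourierTruncate_sub {u : UnitAddTorus d → EuclideanSpace ℝ d}
    (hu : IsSmooth u) : Tendsto (fun N => gradNormSq (fourierTruncate N u - u)) atTop (𝓝 0) := by
  have h := Literature.Analysis.FluidPDE.Torus.tendsto_eGradNormSq_fourierTruncate_sub (hu.memLp 2)
    (eGradNormSq_lt_top hu)
  have h' := (ENNReal.tendsto_toReal ENNReal.zero_ne_top).comp h
  rw [ENNReal.toReal_zero] at h'
  refine h'.congr fun N => ?_
  rw [Function.comp_apply, gradNormSq_eq_toReal_eGradNormSq_holds ((isSmooth_fourierTruncate N u).sub hu)]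

/-- **`‖∇P_N u‖₂² → ‖∇u‖₂²`** for smooth `u` (spectral Pythagoras and the vanishing tail). [folklore] -/
theorem tendsto_gradNormSq_fourierTruncate {u : UnitAddTorus d → EuclideanSpace ℝ d} (hu : IsSmooth u) :
    Tendsto (fun N => gradNormSq (fourierTruncate N u)) atTop (𝓝 (gradNormSq u)) := by
  have h := (tendsto_const_nhds (x := gradNormSq u)).sub (tendsto_gradNormSq_fourierTruncate_sub hu)
  rw [sub_zero] at h
  refine h.congr fun N => ?_
  rw [gradNormSq_eq_add_fourierTruncate hu N]
  ring

/-! ## Truncation against the Laplacian of a band-limited field -/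

/-- **The truncation is invisible against `Δa` for band-limited `a`**: if the smooth field `a` has
no Fourier modes outside the ball `|k|² ≤ N²`, then `∫ ⟪P_N u, Δa⟫ = ∫ ⟪u, Δa⟫` for `u ∈ L²`
(`𝓕(Δa)(k) = -4π²|k|² â(k)` vanishes off the ball too; `Torus.integral_inner_fourierTruncate_eq`).
[folklore] -/
theorem integral_inner_fourierTruncate_laplacian_eq {u a : UnitAddTorus d → EuclideanSpace ℝ d}
    (hu : MemLp u 2 volume) (ha : IsSmooth a) {N : ℕ}
    (hband : ∀ k ∉ freqBall N, mFourierCoeff (EuclideanSpace.complexify ∘ a) k = 0) :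
    ∫ x, ⟪fourierTruncate N u x, laplacian a x⟫_ℝ = ∫ x, ⟪u x, laplacian a x⟫_ℝ :=
  integral_inner_fourierTruncate_eq hu (ha.laplacian.memLp 2) fun k hk => by
    rw [mFourierCoeff_complexify_laplacian ha, hband k hk, smul_zero, neg_zero]

/-! ## Truncation commutes with lattice symmetries -/

/-- **Fourier truncation commutes with conjugation by ball-preserving lattice automorphisms.** Let
`M, M' ∈ M_d(ℤ)` with `M' M = 1` be such that the dual action `k ↦ k M'` preserves the frequency
ball `|k|² ≤ N²`, let `A ∈ M_d(ℤ)`, and let `u : T^d → ℝ^d` be continuous. Then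
`P_N (A_ℝ ∘ u ∘ M•) = A_ℝ ∘ (P_N u) ∘ M•` (`A_ℝ = Matrix.toEuclideanCLM (A.map Int.cast)`,
`M • y = Torus.mulVecT M y`): both sides are smooth with the same Fourier coefficients
`1_{|k| ≤ N} A_ℂ û(k M')` (`Torus.mFourierCoeff_complexify_conj_mulVecT`), hence equal
(`Torus.IsSmooth.ext_mFourierCoeff`). [folklore] -/
theorem fourierTruncate_conj_mulVecT {u : UnitAddTorus d → EuclideanSpace ℝ d} (hu : Continuous u)
    {M M' : Matrix d d ℤ} (h : M' * M = 1) (A : Matrix d d ℤ) {N : ℕ}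
    (hball : ∀ k : d → ℤ, Matrix.vecMul k M' ∈ freqBall N ↔ k ∈ freqBall N) :
    fourierTruncate N (fun y => Matrix.toEuclideanCLM (n := d) (𝕜 := ℝ) (A.map (Int.cast : ℤ → ℝ))
        (u (mulVecT M y))) =
      fun y => Matrix.toEuclideanCLM (n := d) (𝕜 := ℝ) (A.map (Int.cast : ℤ → ℝ))
        (fourierTruncate N u (mulVecT M y)) := by
  set L := Matrix.toEuclideanCLM (n := d) (𝕜 := ℝ) (A.map (Int.cast : ℤ → ℝ)) with hL
  -- the conjugated field and the conjugated truncation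
  have hgc : Continuous fun y => L (u (mulVecT M y)) := L.continuous.comp (hu.comp (continuous_mulVecT M))
  have hgi : Integrable (fun y => L (u (mulVecT M y))) volume := hgc.integrable_unitAddTorus
  have hui : Integrable u volume := hu.integrable_unitAddTorus
  have hPs : IsSmooth (fourierTruncate N fun y => L (u (mulVecT M y))) := isSmooth_fourierTruncate N _
  have hQs : IsSmooth fun y => L (fourierTruncate N u (mulVecT M y)) :=
    ((isSmooth_fourierTruncate N u).comp_mulVecT' M).comp_clm L
  -- compare complexified Fourier coefficients
  have hcoef : ∀ k, mFourierCoeff (EuclideanSpace.complexify ∘ fourierTruncate N fun y => L (u (mulVecT M y))) k =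
      mFourierCoeff (EuclideanSpace.complexify ∘ fun y => L (fourierTruncate N u (mulVecT M y))) k := by
    intro k
    rw [mFourierCoeff_fourierTruncate hgi, hL, mFourierCoeff_complexify_conj_mulVecT hu h A k,
      mFourierCoeff_complexify_conj_mulVecT (continuous_fourierTruncate N u) h A k,
      mFourierCoeff_fourierTruncate hui]
    by_cases hk : k ∈ freqBall N
    · rw [if_pos hk, if_pos ((hball k).2 hk)]
    · rw [if_neg hk, if_neg fun h' => hk ((hball k).1 h'), map_zero]
  have heq := IsSmooth.ext_mFourierCoeff hPs.complexify_comp hQs.complexify_comp hcoef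
  funext y
  exact EuclideanSpace.complexify_injective (congrFun heq y)

end Torus

end Literature.Analysis.FunctionSpaces
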